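import Summits.CriticalPhenomena.PercolationContinuityZ3.Theorems.PercNearOneGluingNoHeavyLowerTailSahiCoSingletonFubini
import Literature.Combinatorics.Sahi2008.UniformCube
import Literature.Combinatorics.Sahi2008.FKG
import Literature.Combinatorics.Sahi2008.Symmetry
import Mathlib.Tactic.Linarith
import Mathlib.Tactic.Ring
import HarnessLib

/-!
# `NoHeavyLowerTail` (stmt-CriticalPhenomena-4575) — the half-co-singleton bound holds whenever TWO SLOTS ARE COMPARABLE

Support file, seat `prim-l12-p5` (gen 3), `--supports stmt-CriticalPhenomena-4575`; uses the plumbing of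
`…SahiHalfCoSingletonChains` / `…SahiCoSingletonFubini`.  No definitions, no named facts, no sorries.

The half-co-singleton bound HC (tree `HalfCoSingletonBound`, P5-REPORT §3h(o)): for every coordinate `j` of a monotone indicator
triple, `Z_{[k]−j} := E[E₃ of the one-coin sections at j] ≤ 2·E₃`.  Gen 2 proved it for every triple with two EQUAL slots
(`coSingletonSum_le_two_mul_sahiE_of_two_equal`).  THIS FILE PROVES IT FOR EVERY TRIPLE WITH TWO COMPARABLE SLOTS:

* `sahiE_three_eq_of_le` — for `f ≤ g` (any weight): `E₃(f,g,h) = (2 − E g)·Cov(f,h) + E f·E[h(1 − g)]`, so `C₃` is immediate on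
  this class (both terms are nonnegative under Harris);
* **`coSingletonSum_le_two_mul_sahiE_of_slot_le`** — for `q ∈ [0,1]^ι`, monotone `{0,1}`-valued `f ≤ g` and ANY monotone `{0,1}`-valued
  `h`, every `j`: `coSingletonSum q ![f,g,h] j ≤ 2·E₃(f,g,h)`;
* `coSingletonSum_comp_perm` — the co-singleton section sum is symmetric in the three slots (from `sahiE_comp_perm`), whence
  **`coSingletonSum_le_two_mul_sahiE_of_comparable`** — HC at every coordinate for every monotone indicator triple in which SOME two
  slots are comparable (`f a ≤ f b`, `a ≠ b`), in any position.

Proof of the main bound (s = q_j; sections `F₀ = f∘lo ≤ F = f∘hi` etc. on the cube of the other coordinates with weight `w`;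
`π_f = F − F₀`).  (1) Pointwise, using `f ≤ g`: the joint-pivotality integrand is `≤ (2−s)·π_fπ_h + H₀·F·(1 − G₀)`.
(2) Law of total covariance + Harris on `w` (pairs `(m_f, H)` and `(F₀,H₀)`, `m_f = sF + (1−s)F₀`):
`Cov(f,h) ≥ s(1−s)·[E_w π_fπ_h + E_w(F H₀) − E_w F·E_w H₀]`.  (3) `E f ≥ s·E_w F`, `E[h(1−g)] ≥ (1−s)·E_w[H₀(1−G₀)]`.
(4) With `E g ≤ 1` and Harris once more (`E_w F · E_w(G₀H₀) ≤ E_w(F G₀ H₀)`):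
`2E₃ − Z ≥ s²(1−s)E_wπ_fπ_h + s(1−s)[E_w(FH₀) + E_w(FG₀H₀) − 2E_wF·E_w(G₀H₀)] ≥ s(1−s)·E_w[F H₀ (1 − G₀)] ≥ 0`.
Exact census behind the statement (seat, gen 3, `code/hc_comparable.py`): all comparable-pair triples on `k ≤ 3` coins × 8 weight
vectors and 4 000 sampled at `k = 4` × 6 vectors (177 k (triple,q,j) cells): `0` violations of each displayed intermediate inequality.
-/

namespace Summit.CriticalPhenomena.PercolationContinuityZ3.Theorems

namespace SahiCoSingleton

open Finset Literature.Combinatorics.Sahi2008 SahiSubsetChord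

variable {ι : Type*} [Fintype ι] [DecidableEq ι]

/-- **`E₃` of a comparable pair.**  For `{0,1}`-valued `f` with `f ≤ g ≤ 1` and any `h`, any weight `μ`:
`E₃(f,g,h) = (2 − E g)·(E(fh) − E f·E h) + E f·(E h − E(gh))`. [this file] -/
theorem sahiE_three_eq_of_le (μ : (ι → Bool) → ℝ) (f g h : (ι → Bool) → ℝ) (hf01 : ∀ x, f x = 0 ∨ f x = 1)
    (hg1 : ∀ x, g x ≤ 1) (hfg : ∀ x, f x ≤ g x) :
    sahiE μ 3 ![f, g, h]
      = (2 - ex μ g) * (ex μ (f * h) - ex μ f * ex μ h) + ex μ f * (ex μ h - ex μ (g * h)) := by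
  have hfg' : f * g = f := by
    funext x; simp only [Pi.mul_apply]
    rcases hf01 x with e | e
    · rw [e]; ring
    · have : g x = 1 := le_antisymm (hg1 x) (by rw [← e]; exact hfg x)
      rw [e, this]; ring
  rw [sahiE_three_apply]
  simp only [Matrix.cons_val_zero, Matrix.cons_val_one, Matrix.head_cons, Matrix.cons_val_two, Matrix.tail_cons]
  rw [hfg']
  ring

/-- The co-singleton section sum is symmetric in the three slots. [this file] -/
theorem coSingletonSum_comp_perm (q : ι → ℝ) (f : Fin 3 → (ι → Bool) → ℝ) (σ : Equiv.Perm (Fin 3)) (j : ι) :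
    coSingletonSum q (fun a => f (σ a)) j = coSingletonSum q f j := by
  unfold coSingletonSum
  refine Finset.sum_congr rfl fun v _ => ?_
  congr 1
  exact sahiE_comp_perm _ 3 σ (fun a y => f a (glue ((univ : Finset ι).erase j) v y))

/-- Pointwise comparison of the joint-pivotality integrand for a comparable pair (`{0,1}` case analysis): with section values
`f₀ ≤ f₁`, `g₀ ≤ g₁`, `h₀ ≤ h₁` in `{0,1}`, `f₀ ≤ g₀`, `f₁ ≤ g₁` and `s ≤ 1`,
`(2−s)π_fπ_gπ_h + f₀π_gπ_h + g₀π_fπ_h + h₀π_fπ_g ≤ (2−s)π_fπ_h + h₀f₁(1−g₀)`. [this file] -/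
theorem jointPivotality_integrand_le_of_le {s f₀ f₁ g₀ g₁ h₀ h₁ : ℝ} (hs1 : s ≤ 1)
    (hf0 : f₀ = 0 ∨ f₀ = 1) (hf1 : f₁ = 0 ∨ f₁ = 1) (hg0 : g₀ = 0 ∨ g₀ = 1) (hg1 : g₁ = 0 ∨ g₁ = 1)
    (hh0 : h₀ = 0 ∨ h₀ = 1) (hh1 : h₁ = 0 ∨ h₁ = 1) (mf : f₀ ≤ f₁) (mg : g₀ ≤ g₁) (mh : h₀ ≤ h₁)
    (c0 : f₀ ≤ g₀) (c1 : f₁ ≤ g₁) :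
    (2 - s) * ((f₁ - f₀) * (g₁ - g₀) * (h₁ - h₀))
        + (f₀ * ((g₁ - g₀) * (h₁ - h₀)) + g₀ * ((f₁ - f₀) * (h₁ - h₀)) + h₀ * ((f₁ - f₀) * (g₁ - g₀)))
      ≤ (2 - s) * ((f₁ - f₀) * (h₁ - h₀)) + h₀ * f₁ * (1 - g₀) := by
  rcases hf0 with rfl | rfl <;> rcases hf1 with rfl | rfl <;> rcases hg0 with rfl | rfl <;>
    rcases hg1 with rfl | rfl <;> rcases hh0 with rfl | rfl <;> rcases hh1 with rfl | rfl <;>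
    linarith

/-- **HC for a comparable pair in the first two slots**: for monotone `{0,1}`-valued `f ≤ g` and any monotone `{0,1}`-valued `h`,
every product weight and every coordinate `j`, `E[E₃ of the one-coin sections of (f,g,h) at j] ≤ 2·E₃(f,g,h)`. [this file] -/
theorem coSingletonSum_le_two_mul_sahiE_of_slot_le (q : ι → ℝ) (hq : ∀ i, 0 ≤ q i ∧ q i ≤ 1) (f g h : (ι → Bool) → ℝ)
    (hf01 : ∀ x, f x = 0 ∨ f x = 1) (hg01 : ∀ x, g x = 0 ∨ g x = 1) (hh01 : ∀ x, h x = 0 ∨ h x = 1)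
    (hfm : Monotone f) (hgm : Monotone g) (hhm : Monotone h) (hfg : ∀ x, f x ≤ g x) (j : ι) :
    coSingletonSum q ![f, g, h] j ≤ 2 * sahiE (prodWeight q) 3 ![f, g, h] := by
  -- bookkeeping
  have hind : ∀ a x, (![f, g, h] : Fin 3 → (ι → Bool) → ℝ) a x = 0 ∨ (![f, g, h] : Fin 3 → (ι → Bool) → ℝ) a x = 1 := by
    intro a x; fin_cases a
    · exact hf01 x
    · exact hg01 x
    · exact hh01 x
  have hmono : ∀ a, Monotone ((![f, g, h] : Fin 3 → (ι → Bool) → ℝ) a) := by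
    intro a; fin_cases a
    · exact hfm
    · exact hgm
    · exact hhm
  have hf0 : ∀ x, 0 ≤ f x := fun x => by rcases hf01 x with e | e <;> simp [e]
  have hg0 : ∀ x, 0 ≤ g x := fun x => by rcases hg01 x with e | e <;> simp [e]
  have hg1 : ∀ x, g x ≤ 1 := fun x => by rcases hg01 x with e | e <;> simp [e]
  have hh0 : ∀ x, 0 ≤ h x := fun x => by rcases hh01 x with e | e <;> simp [e]
  have hh1 : ∀ x, h x ≤ 1 := fun x => by rcases hh01 x with e | e <;> simp [e]
  set s := q j with hs
  have hs0 : 0 ≤ s := (hq j).1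
  have hs1 : s ≤ 1 := (hq j).2
  have hss : 0 ≤ s * (1 - s) := mul_nonneg hs0 (sub_nonneg.mpr hs1)
  set w : ({i // i ∈ (univ : Finset ι).erase j} → Bool) → ℝ :=
    prodWeight (fun i : {i // i ∈ (univ : Finset ι).erase j} => q i) with hw
  have hw0 : ∀ v, 0 ≤ w v := fun v =>
    prodWeight_nonneg (q := fun i : {i // i ∈ (univ : Finset ι).erase j} => q i) (fun i => hq i) v
  have hFKGw : IsFKGMeasure w := isFKGMeasure_coinWeight (fun i => hq i)
  have hFKG : IsFKGMeasure (prodWeight q) := isFKGMeasure_coinWeight hq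
  have hsum : ∑ x, prodWeight q x = 1 := sum_coinWeight q
  -- the five expectations on the whole cube
  set a := ex (prodWeight q) f with ha_def
  set b := ex (prodWeight q) g with hb_def
  set c := ex (prodWeight q) h with hc_def
  set A := ex (prodWeight q) (f * h) with hA_def
  set B := ex (prodWeight q) (g * h) with hB_def
  have hE3 : sahiE (prodWeight q) 3 ![f, g, h] = (2 - b) * (A - a * c) + a * (c - B) :=
    sahiE_three_eq_of_le (prodWeight q) f g h hf01 hg1 hfg
  have ha0 : 0 ≤ a := ex_nonneg (fun x => prodWeight_nonneg hq x) hf0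
  have hb1 : b ≤ 1 := by
    have := ex_mono (μ := prodWeight q) (fun x => prodWeight_nonneg hq x) hg1
    rwa [ex_const hsum] at this
  -- Harris on the whole cube: a·c ≤ A
  have hAc : a * c ≤ A := ex_mul_ex_le_ex_mul hFKG hf0 hh0 hfm hhm
  -- splitting the five expectations along coordinate j
  have ha : a = s * (∑ v, w v * f (hi j v)) + (1 - s) * (∑ v, w v * f (lo j v)) := by
    rw [ha_def]; exact ex_eq_hi_lo q j f
  have hc : c = s * (∑ v, w v * h (hi j v)) + (1 - s) * (∑ v, w v * h (lo j v)) := by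
    rw [hc_def]; exact ex_eq_hi_lo q j h
  have hA : A = s * (∑ v, w v * (f (hi j v) * h (hi j v))) + (1 - s) * (∑ v, w v * (f (lo j v) * h (lo j v))) := by
    rw [hA_def]; exact ex_eq_hi_lo q j (f * h)
  have hB : B = s * (∑ v, w v * (g (hi j v) * h (hi j v))) + (1 - s) * (∑ v, w v * (g (lo j v) * h (lo j v))) := by
    rw [hB_def]; exact ex_eq_hi_lo q j (g * h)
  -- monotonicity / nonnegativity of the section functions on the co-singleton cube
  have mFhi : Monotone (fun v => f (hi j v)) := fun v v' hvv' => hfm (hi_mono j hvv')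
  have mFlo : Monotone (fun v => f (lo j v)) := fun v v' hvv' => hfm (lo_mono j hvv')
  have mHhi : Monotone (fun v => h (hi j v)) := fun v v' hvv' => hhm (hi_mono j hvv')
  have mHlo : Monotone (fun v => h (lo j v)) := fun v v' hvv' => hhm (lo_mono j hvv')
  have mGHlo : Monotone (fun v => g (lo j v) * h (lo j v)) := fun v v' hvv' =>
    mul_le_mul (hgm (lo_mono j hvv')) (hhm (lo_mono j hvv')) (hh0 _) (hg0 _)
  -- (H1) Harris on w: (F₀, H₀)
  have H1 : (∑ v, w v * f (lo j v)) * (∑ v, w v * h (lo j v)) ≤ ∑ v, w v * (f (lo j v) * h (lo j v)) := by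
    have key := ex_mul_ex_le_ex_mul hFKGw (f := fun v => f (lo j v)) (g := fun v => h (lo j v))
      (fun v => hf0 _) (fun v => hh0 _) mFlo mHlo
    simpa [ex, Pi.mul_apply] using key
  -- (H2) Harris on w: (m_f, H) with m_f = s·F + (1−s)·F₀
  have H2 : (s * (∑ v, w v * f (hi j v)) + (1 - s) * (∑ v, w v * f (lo j v))) * (∑ v, w v * h (hi j v))
      ≤ s * (∑ v, w v * (f (hi j v) * h (hi j v))) + (1 - s) * (∑ v, w v * (f (lo j v) * h (hi j v))) := by
    set fb : ({i // i ∈ (univ : Finset ι).erase j} → Bool) → ℝ := fun v => s * f (hi j v) + (1 - s) * f (lo j v)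
      with hfb
    have hfb0 : ∀ v, 0 ≤ fb v := fun v =>
      add_nonneg (mul_nonneg hs0 (hf0 _)) (mul_nonneg (sub_nonneg.mpr hs1) (hf0 _))
    have hfbm : Monotone fb := by
      intro v v' hvv'
      have h1 := hfm (hi_mono j hvv'); have h2 := hfm (lo_mono j hvv')
      exact add_le_add (mul_le_mul_of_nonneg_left h1 hs0) (mul_le_mul_of_nonneg_left h2 (sub_nonneg.mpr hs1))
    have key := ex_mul_ex_le_ex_mul hFKGw (f := fb) (g := fun v => h (hi j v)) hfb0 (fun v => hh0 _) hfbm mHhi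
    unfold ex at key
    have e1 : ∑ v, w v * fb v = s * (∑ v, w v * f (hi j v)) + (1 - s) * (∑ v, w v * f (lo j v)) := by
      rw [Finset.mul_sum, Finset.mul_sum, ← Finset.sum_add_distrib]
      refine Finset.sum_congr rfl fun v _ => ?_
      simp only [hfb]; ring
    have e2 : ∑ v, w v * (fb * fun v => h (hi j v)) v
        = s * (∑ v, w v * (f (hi j v) * h (hi j v))) + (1 - s) * (∑ v, w v * (f (lo j v) * h (hi j v))) := by
      rw [Finset.mul_sum, Finset.mul_sum, ← Finset.sum_add_distrib]
      refine Finset.sum_congr rfl fun v _ => ?_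
      simp only [hfb, Pi.mul_apply]; ring
    rw [e1, e2] at key
    exact key
  -- (H3) Harris on w: (F, G₀H₀) — the key step
  have H3 : (∑ v, w v * f (hi j v)) * (∑ v, w v * (g (lo j v) * h (lo j v)))
      ≤ ∑ v, w v * (f (hi j v) * (g (lo j v) * h (lo j v))) := by
    have key := ex_mul_ex_le_ex_mul hFKGw (f := fun v => f (hi j v)) (g := fun v => g (lo j v) * h (lo j v))
      (fun v => hf0 _) (fun v => mul_nonneg (hg0 _) (hh0 _)) mFhi mGHlo
    simpa [ex, Pi.mul_apply] using key
  -- pointwise sums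
  have P1 : ∑ v, w v * (g (hi j v) * h (hi j v)) ≤ ∑ v, w v * h (hi j v) :=
    Finset.sum_le_sum fun v _ => mul_le_mul_of_nonneg_left (mul_le_of_le_one_left (hh0 _) (hg1 _)) (hw0 v)
  have P2 : ∑ v, w v * (g (lo j v) * h (lo j v)) ≤ ∑ v, w v * h (lo j v) :=
    Finset.sum_le_sum fun v _ => mul_le_mul_of_nonneg_left (mul_le_of_le_one_left (hh0 _) (hg1 _)) (hw0 v)
  have P3 : ∑ v, w v * (f (hi j v) * (g (lo j v) * h (lo j v))) ≤ ∑ v, w v * (f (hi j v) * h (lo j v)) :=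
    Finset.sum_le_sum fun v _ => mul_le_mul_of_nonneg_left
      (mul_le_mul_of_nonneg_left (mul_le_of_le_one_left (hh0 _) (hg1 _)) (hf0 _)) (hw0 v)
  have P4 : 0 ≤ ∑ v, w v * f (lo j v) := Finset.sum_nonneg fun v _ => mul_nonneg (hw0 v) (hf0 _)
  have P5 : 0 ≤ ∑ v, w v * ((f (hi j v) - f (lo j v)) * (h (hi j v) - h (lo j v))) := by
    refine Finset.sum_nonneg fun v _ => mul_nonneg (hw0 v) (mul_nonneg ?_ ?_)
    · have hlohi : lo j v ≤ hi j v := by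
        intro i; unfold lo hi glue; split_ifs
        · exact le_rfl
        · exact Bool.false_le _
      exact sub_nonneg.mpr (hfm hlohi)
    · have hlohi : lo j v ≤ hi j v := by
        intro i; unfold lo hi glue; split_ifs
        · exact le_rfl
        · exact Bool.false_le _
      exact sub_nonneg.mpr (hhm hlohi)
  -- the π-product sum and the N-sum in terms of the section sums
  have hPI : ∑ v, w v * ((f (hi j v) - f (lo j v)) * (h (hi j v) - h (lo j v)))
      = (∑ v, w v * (f (hi j v) * h (hi j v))) - (∑ v, w v * (f (hi j v) * h (lo j v)))
        - (∑ v, w v * (f (lo j v) * h (hi j v))) + (∑ v, w v * (f (lo j v) * h (lo j v))) := by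
    rw [← Finset.sum_sub_distrib, ← Finset.sum_sub_distrib, ← Finset.sum_add_distrib]
    exact Finset.sum_congr rfl fun v _ => by ring
  have hNN : ∑ v, w v * (h (lo j v) * f (hi j v) * (1 - g (lo j v)))
      = (∑ v, w v * (f (hi j v) * h (lo j v))) - (∑ v, w v * (f (hi j v) * (g (lo j v) * h (lo j v)))) := by
    rw [← Finset.sum_sub_distrib]
    exact Finset.sum_congr rfl fun v _ => by ring
  -- (1) Z = s(1−s)·J and the pointwise bound on the J-integrand
  rw [coSingletonSum_eq q _ hind hmono j, ← hs]
  have hJ : jointPivotality q ![f, g, h] j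
      ≤ (2 - s) * (∑ v, w v * ((f (hi j v) - f (lo j v)) * (h (hi j v) - h (lo j v))))
        + ∑ v, w v * (h (lo j v) * f (hi j v) * (1 - g (lo j v))) := by
    unfold jointPivotality
    rw [← hs, Finset.mul_sum, ← Finset.sum_add_distrib]
    refine Finset.sum_le_sum fun v _ => ?_
    simp only [Matrix.cons_val_zero, Matrix.cons_val_one, Matrix.head_cons, Matrix.cons_val_two, Matrix.tail_cons]
    have hlohi : lo j v ≤ hi j v := by
      intro i; unfold lo hi glue; split_ifs
      · exact le_rfl
      · exact Bool.false_le _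
    have key := jointPivotality_integrand_le_of_le (s := s) hs1 (hf01 (lo j v)) (hf01 (hi j v)) (hg01 (lo j v))
      (hg01 (hi j v)) (hh01 (lo j v)) (hh01 (hi j v)) (hfm hlohi) (hgm hlohi) (hhm hlohi) (hfg _) (hfg _)
    have := mul_le_mul_of_nonneg_left key (hw0 v)
    linarith only [this]
  -- (2) law of total covariance + Harris (H1, H2): the conditional covariance lower bound
  have hQ : s * (1 - s) * (∑ v, w v * ((f (hi j v) - f (lo j v)) * (h (hi j v) - h (lo j v))))
      + s * (1 - s) * ((∑ v, w v * (f (hi j v) * h (lo j v)))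
          - (∑ v, w v * f (hi j v)) * (∑ v, w v * h (lo j v)))
      ≤ A - a * c := by
    have e : A - a * c
        - (s * (1 - s) * (∑ v, w v * ((f (hi j v) - f (lo j v)) * (h (hi j v) - h (lo j v))))
            + s * (1 - s) * ((∑ v, w v * (f (hi j v) * h (lo j v)))
              - (∑ v, w v * f (hi j v)) * (∑ v, w v * h (lo j v))))
        = s * (s * (∑ v, w v * (f (hi j v) * h (hi j v))) + (1 - s) * (∑ v, w v * (f (lo j v) * h (hi j v)))
              - (s * (∑ v, w v * f (hi j v)) + (1 - s) * (∑ v, w v * f (lo j v))) * (∑ v, w v * h (hi j v)))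
          + (1 - s) ^ 2 * ((∑ v, w v * (f (lo j v) * h (lo j v)))
              - (∑ v, w v * f (lo j v)) * (∑ v, w v * h (lo j v))) := by
      rw [hA, ha, hc, hPI]; ring
    have t1 : 0 ≤ s * (s * (∑ v, w v * (f (hi j v) * h (hi j v))) + (1 - s) * (∑ v, w v * (f (lo j v) * h (hi j v)))
              - (s * (∑ v, w v * f (hi j v)) + (1 - s) * (∑ v, w v * f (lo j v))) * (∑ v, w v * h (hi j v))) :=
      mul_nonneg hs0 (sub_nonneg.mpr H2)
    have t2 : 0 ≤ (1 - s) ^ 2 * ((∑ v, w v * (f (lo j v) * h (lo j v)))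
              - (∑ v, w v * f (lo j v)) * (∑ v, w v * h (lo j v))) :=
      mul_nonneg (sq_nonneg _) (sub_nonneg.mpr H1)
    linarith only [e, t1, t2]
  -- (3) a ≥ s·E_w F and c − B ≥ (1−s)·E_w[H₀(1−G₀)], both sides nonnegative
  have ha_lb : s * (∑ v, w v * f (hi j v)) ≤ a := by
    rw [ha]
    have := mul_nonneg (sub_nonneg.mpr hs1) P4
    linarith only [this]
  have hcB_lb : (1 - s) * ((∑ v, w v * h (lo j v)) - (∑ v, w v * (g (lo j v) * h (lo j v)))) ≤ c - B := by
    rw [hc, hB]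
    have := mul_nonneg hs0 (sub_nonneg.mpr P1)
    linarith only [this]
  have hcB0 : 0 ≤ (1 - s) * ((∑ v, w v * h (lo j v)) - (∑ v, w v * (g (lo j v) * h (lo j v)))) :=
    mul_nonneg (sub_nonneg.mpr hs1) (sub_nonneg.mpr P2)
  have hEhg : (s * (∑ v, w v * f (hi j v)))
        * ((1 - s) * ((∑ v, w v * h (lo j v)) - (∑ v, w v * (g (lo j v) * h (lo j v)))))
      ≤ a * (c - B) := mul_le_mul ha_lb hcB_lb hcB0 ha0
  -- (4) assemble
  rw [hNN] at hJ
  have f1 : s * (1 - s) * jointPivotality q ![f, g, h] j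
      ≤ s * (1 - s) * ((2 - s) * (∑ v, w v * ((f (hi j v) - f (lo j v)) * (h (hi j v) - h (lo j v))))
        + ((∑ v, w v * (f (hi j v) * h (lo j v))) - (∑ v, w v * (f (hi j v) * (g (lo j v) * h (lo j v)))))) :=
    mul_le_mul_of_nonneg_left hJ hss
  have f4 : 0 ≤ (1 - b) * (A - a * c) := mul_nonneg (sub_nonneg.mpr hb1) (sub_nonneg.mpr hAc)
  have f6 : s * (1 - s) * ((∑ v, w v * f (hi j v)) * (∑ v, w v * (g (lo j v) * h (lo j v))))
      ≤ s * (1 - s) * (∑ v, w v * (f (hi j v) * (g (lo j v) * h (lo j v)))) :=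
    mul_le_mul_of_nonneg_left H3 hss
  have f8 : 0 ≤ s * (s * (1 - s)) * (∑ v, w v * ((f (hi j v) - f (lo j v)) * (h (hi j v) - h (lo j v)))) :=
    mul_nonneg (mul_nonneg hs0 hss) P5
  have f9 : 0 ≤ s * (1 - s) * ((∑ v, w v * (f (hi j v) * h (lo j v)))
      - (∑ v, w v * (f (hi j v) * (g (lo j v) * h (lo j v))))) :=
    mul_nonneg hss (sub_nonneg.mpr P3)
  rw [hE3]
  linarith only [f1, hQ, f4, hEhg, f6, f8, f9]

/-- **HC whenever two slots are comparable.**  For a monotone `{0,1}`-valued triple `f` on a finite product cube in which some two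
slots are comparable (`f a ≤ f b` pointwise, `a ≠ b`) and every coordinate `j`:
`E[E₃ of the one-coin sections at j] ≤ 2·E₃(f)` — the half-co-singleton bound `HalfCoSingletonBound` on this class. [this file] -/
theorem coSingletonSum_le_two_mul_sahiE_of_comparable (q : ι → ℝ) (hq : ∀ i, 0 ≤ q i ∧ q i ≤ 1)
    (f : Fin 3 → (ι → Bool) → ℝ) (hind : ∀ a x, f a x = 0 ∨ f a x = 1) (hmono : ∀ a, Monotone (f a))
    {a b : Fin 3} (hab : a ≠ b) (hle : ∀ x, f a x ≤ f b x) (j : ι) :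
    coSingletonSum q f j ≤ 2 * sahiE (prodWeight q) 3 f := by
  -- reduction to the displayed order through a permutation of the slots
  have main : ∀ σ : Equiv.Perm (Fin 3), (∀ x, f (σ 0) x ≤ f (σ 1) x) →
      coSingletonSum q f j ≤ 2 * sahiE (prodWeight q) 3 f := by
    intro σ hσ
    have key := coSingletonSum_le_two_mul_sahiE_of_slot_le q hq (f (σ 0)) (f (σ 1)) (f (σ 2)) (hind _) (hind _)
      (hind _) (hmono _) (hmono _) (hmono _) hσ j
    have hfσ : (fun i => f (σ i)) = ![f (σ 0), f (σ 1), f (σ 2)] := by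
      funext i; fin_cases i <;> rfl
    rw [← hfσ, coSingletonSum_comp_perm q f σ j, sahiE_comp_perm (prodWeight q) 3 σ f] at key
    exact key
  -- the six ordered cases
  fin_cases a <;> fin_cases b
  · exact absurd rfl hab
  · exact main (Equiv.refl _) hle
  · refine main (Equiv.swap 1 2) (fun x => ?_)
    rw [show (Equiv.swap (1 : Fin 3) 2) 0 = 0 by decide, show (Equiv.swap (1 : Fin 3) 2) 1 = 2 by decide]
    exact hle x
  · refine main (Equiv.swap 0 1) (fun x => ?_)
    rw [show (Equiv.swap (0 : Fin 3) 1) 0 = 1 by decide, show (Equiv.swap (0 : Fin 3) 1) 1 = 0 by decide]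
    exact hle x
  · exact absurd rfl hab
  · refine main ((Equiv.swap 0 1).trans (Equiv.swap 0 2)) (fun x => ?_)
    rw [show ((Equiv.swap (0 : Fin 3) 1).trans (Equiv.swap 0 2)) 0 = 1 by decide,
      show ((Equiv.swap (0 : Fin 3) 1).trans (Equiv.swap 0 2)) 1 = 2 by decide]
    exact hle x
  · refine main ((Equiv.swap 0 1).trans (Equiv.swap 1 2)) (fun x => ?_)
    rw [show ((Equiv.swap (0 : Fin 3) 1).trans (Equiv.swap 1 2)) 0 = 2 by decide,
      show ((Equiv.swap (0 : Fin 3) 1).trans (Equiv.swap 1 2)) 1 = 0 by decide]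
    exact hle x
  · refine main (Equiv.swap 0 2) (fun x => ?_)
    rw [show (Equiv.swap (0 : Fin 3) 2) 0 = 2 by decide, show (Equiv.swap (0 : Fin 3) 2) 1 = 1 by decide]
    exact hle x
  · exact absurd rfl hab

end SahiCoSingleton

end Summit.CriticalPhenomena.PercolationContinuityZ3.Theorems
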